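import Summits.QuantumFields.YangMills.Theorems.BalabanUVNodesN08TrivialHistoryDominates
import Literature.MathematicalPhysics.QuantumFieldTheory.Balaban1983to89.B12RTGaugeInvariance254

/-!
# BalabanUVNodes ∕ N08 — THE FLOORED HAAR ITERATE AND ALL PARTIAL ITERATED PUSH-FORWARDS OF HAAR UNDER A COVARIANT AVERAGING ARE GAUGE-INVARIANT MEASURES: the
# transport residual of the [B10] slot (files 28–30: «`f_k ≤ e^{c_m|T₁^{(k)}|}` a.e.» ∕ (a)′∀) is a statement about GAUGE-INVARIANT measures on the coarse fields

Track A, DAG node N08 = T. Bałaban, CMP **102** (1985) 255–275 [Balaban1985UV3]: (2) p. 256 («ρ_{k+1} = Tρ_k»), (41) p. 266 + (47) p. 267 (the history masses, the trivial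
term); the averaging and its covariance = [Balaban1985Averaging] (11)–(12) p. 19; the coarse gauge transformations «V → V^v» induced through the covariance of the averages =
[Balaban1987RG1] p. 265 after (2.1) (tree: `B12RTGaugeInvariance254`: `liftTransf`, `avg_gaugeAct_liftTransf`, `measurePreserving_gaugeAct`).  Cell `pub-ymgap`, width seat
`pub-ymgap-dag-n08-w1` (g6), W-SEAT-START-LIST §n08 item 1 successor piece (o25) = file 31; `--supports` K1⁹ `StabilityBRunRowsAtRecordR13SepCoPHV` (stmt-QuantumFields-27364,
KEY MAP v2; helper).  Companion of files 28 (`…N08TrivialHistoryDominates`: `m_k(triv,·)·dU_k = dU_k + ν♯_k`), 30 (`…N08PartialIteratesNecessity`) and of the Literature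
module `AveragingImageLawGaugeInvariance` (the ONE-step image law `Ū_*(dU)` is gauge invariant; here: every iterate, every start measure, and the floored iterate).

WHAT THIS FILE PROVES (kernel; theorems only, 0 def; [folklore] measure theory + the printed covariance; nothing else of the papers asserted).  For ANY covariant averaging
family `av` (`Setup.Averaging`, covariance (11) is a field) with measurable `Ū_j`, in the standing range:
* §1 `map_gaugeAct_map_avg_of_invariant` — **gauge invariance PROPAGATES through one averaging step**: if `μ` on the level-`j` fields is invariant under every gauge
  transformation, so is `μ∘Ū_j⁻¹` under every level-`(j+1)` gauge transformation (`Ū(U^{v∘blockOf}) = (ŪU)^v`); `map_gaugeAct_partialIterates` — hence EVERY partial iterated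
  push-forward `ι_{j,k} = (Ū_{k−1}∘⋯∘Ū_j)_*dU_j` of the reference measure (file 27's hypotheses) is gauge invariant (`dU_j` is: `measurePreserving_gaugeAct`).
* §2 `map_sub_of_inverse` — truncated subtraction of finite measures commutes with the push-forward along a measurable bijection with measurable inverse ([folklore]);
  §2b `map_withDensity_of_map_eq` ∕ `comp_ae_eq_of_map_withDensity_eq` — push-forward of a measure with density along a `μ`-preserving bijection; a.e. invariance of the density;
  ★★ `map_gaugeAct_add_excessRec` — for every excess-recursive family `ν♯` of file 17 §4, `dU_k + ν♯_k` is gauge invariant (`k ≤ m + K`); with file 28 §2: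
  ★★★ `map_gaugeAct_withDensity_massRecAC_triv` — **THE FLOORED HAAR ITERATE IS A GAUGE-INVARIANT MEASURE: `(m_k(triv,·)·dU_k)∘(·)^v⁻¹ = m_k(triv,·)·dU_k`** for every
  level-`k` gauge transformation `v`, `k ≤ m + K`, any thresholds; ★★ `massRecAC_triv_comp_gaugeAct_ae_eq` ∕ `…'` — **in density currency: `m_k(triv, V^v) = m_k(triv, V)`
  for `dU_k`-a.e. `V`** (uniqueness of densities).
* §3 at the [B10] slot's averaging `avOfPrint N S` on `SU(N)`: `map_gaugeAct_partialIterates_avOfPrint`, `map_gaugeAct_withDensity_massRecAC_triv_avOfPrint`,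
  `massRecAC_triv_avOfPrint_comp_gaugeAct_ae_eq`.

LOCATED READING (count-neutral; the n08-w3∕w6 analysis lineage decides how to use it): the three faces (F)∕(P)∕(N) of the node's transport residual (file 30's R4¹²) concern
GAUGE-INVARIANT measures on the level-`k` fields compared with the gauge-invariant `dU_k`; by n08-w3's `…HaarCompatibilityInvariantObservables.measure_eq_of_forall_gaugeInvariant`
mechanism such measures are determined by gauge-invariant observables (holonomy functionals), so the extensive density bounds may be established on any gauge-fixed section
that carries the invariant σ-algebra — bookkeeping only; no bound is claimed.

HONEST FRAMING: count-neutral helper; (a)′ ∕ (a)′∀ ∕ E6′ NOT decided; `PrintedUV3V` NOT proved; N08 NOT discharged; one finite 𝕋⁴ programme at fixed ε, Bałaban AS PRINTED —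
R4 closes the conditional finite-𝕋⁴ rung `BalabanLadder.UV` only; the Yang–Mills mass gap (Clay) is NOT proved by any of this; nothing continuum ∕ ℝ⁴ ∕ OS.  No `sorry`,
standard axioms.
-/

noncomputable section

open MeasureTheory
open scoped ENNReal

namespace Summit.QuantumFields.YangMills.BalabanUVNodes.N08FlooredIterateGaugeInvariant

open Literature.MathematicalPhysics.QuantumFieldTheory.Balaban1983to89
open Literature.MathematicalPhysics.QuantumFieldTheory.Balaban1983to89.B12RTGaugeInvariance254
  (liftTransf invTransf avg_gaugeAct_liftTransf measurable_gaugeAct measurePreserving_gaugeAct gaugeAct_inv_gaugeAct gaugeAct_gaugeAct_inv)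
open Summit.QuantumFields.Balaban3D.Carriers
open Summit.QuantumFields.Balaban3D.Proofs.MassesAC
open Summit.QuantumFields.YangMills.BalabanUVNodes.N08MassesACLeastClosedFamily (exists_excessRec isFiniteMeasure_of_excessRec)
open Summit.QuantumFields.YangMills.BalabanUVNodes.N08TrivialHistoryDominates (withDensity_massRecAC_triv_eq_add_excessRec)

/-! ## §1 Gauge invariance propagates through a covariant averaging step; the partial iterates are gauge invariant -/
section Propagate

variable {P : Params} {G : Type} [GaugeGroup G] [MeasurableSpace G] [HaarData G] [MeasurableMul₂ G] (av : ∀ j, Averaging P j G)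
  (hmeas : ∀ j, Measurable (av j).avg)
include hmeas

omit [HaarData G] in
/-- ★ **GAUGE INVARIANCE PROPAGATES THROUGH ONE COVARIANT AVERAGING STEP**: if a measure `μ` on the level-`j` fields is invariant under every gauge transformation, then
`μ∘Ū_j⁻¹` is invariant under every level-`(j+1)` gauge transformation `v` (`j + 1 ≤ m + K`): `(·)^v ∘ Ū_j = Ū_j ∘ (·)^{v∘blockOf}` (`avg_gaugeAct_liftTransf`,
[Balaban1985Averaging] (11)) and `μ` absorbs the block-constant lift. [cite: Balaban1985Averaging, (11) p.19; Balaban1987RG1, (2.1) p.265] -/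
theorem map_gaugeAct_map_avg_of_invariant {j : ℕ} (hj : j + 1 ≤ P.m + P.K) (μ : Measure (GaugeField P j G))
    (hμ : ∀ u : GaugeTransf P j G, μ.map (GaugeField.gaugeAct u) = μ) (v : GaugeTransf P (j + 1) G) :
    (μ.map (av j).avg).map (GaugeField.gaugeAct v) = μ.map (av j).avg := by
  rw [Measure.map_map (measurable_gaugeAct v) (hmeas j)]
  have hcomp : (GaugeField.gaugeAct v ∘ (av j).avg : GaugeField P j G → GaugeField P (j + 1) G) =
      (av j).avg ∘ GaugeField.gaugeAct (liftTransf v) := by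
    funext U
    simp only [Function.comp_apply, avg_gaugeAct_liftTransf hj (av j) v U]
  rw [hcomp, ← Measure.map_map (hmeas j) (measurable_gaugeAct _), hμ]

/-- ★ **EVERY PARTIAL ITERATED PUSH-FORWARD OF THE REFERENCE MEASURE IS GAUGE INVARIANT**: with `ι_{j,j} = dU_j`, `ι_{j,k+1} = ι_{j,k}∘Ū_k⁻¹` (file 27's hypotheses),
`ι_{j,k}∘(·)^v⁻¹ = ι_{j,k}` for every level-`k` gauge transformation `v`, all `j ≤ k ≤ m + K` (`dU_j` is gauge invariant — `measurePreserving_gaugeAct`, [Balaban1985Averaging]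
(12) — and §1 at each step). [cite: Balaban1985Averaging, (11)+(12) p.19; Balaban1985UV3, (2) p.256 (bookkeeping)] -/
theorem map_gaugeAct_partialIterates (ι : ∀ j k : ℕ, Measure (GaugeField P k G)) (hι0 : ∀ j, ι j j = fieldMeasure P j G)
    (hιs : ∀ j k, j ≤ k → ι j (k + 1) = (ι j k).map (av k).avg) :
    ∀ k, k ≤ P.m + P.K → ∀ j, j ≤ k → ∀ v : GaugeTransf P k G, (ι j k).map (GaugeField.gaugeAct v) = ι j k
  | 0, _, j, hj, v => by
    obtain rfl : j = 0 := Nat.le_zero.1 hj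
    rw [hι0]; exact (measurePreserving_gaugeAct v).map_eq
  | k + 1, hk, j, hj, v => by
    by_cases hjk : j = k + 1
    · subst hjk; rw [hι0]; exact (measurePreserving_gaugeAct v).map_eq
    · have hj' : j ≤ k := by omega
      rw [hιs j k hj']
      exact map_gaugeAct_map_avg_of_invariant av hmeas (by omega) (ι j k) (map_gaugeAct_partialIterates ι hι0 hιs k (by omega) j hj') v

end Propagate

/-! ## §2 The floored iterate (the trivial history's mass measure) is gauge invariant -/
section MapSub

variable {α β : Type*} [MeasurableSpace α] [MeasurableSpace β]

/-- **Truncated subtraction of finite measures commutes with the push-forward along a measurable bijection with measurable inverse**: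
`(μ − λ)∘g⁻¹ = μ∘g⁻¹ − λ∘g⁻¹` (`μ − λ` is the least `τ` with `μ ≤ τ + λ`; push forward both characterisations along `g` and its inverse). [folklore] -/
theorem map_sub_of_inverse {g : α → β} {g' : β → α} (hg : Measurable g) (hg' : Measurable g') (hgg' : g ∘ g' = id) (hg'g : g' ∘ g = id)
    (μ ν : Measure α) [IsFiniteMeasure μ] [IsFiniteMeasure ν] :
    (μ - ν).map g = μ.map g - ν.map g := by
  haveI : IsFiniteMeasure (μ.map g) := inferInstance
  haveI : IsFiniteMeasure (ν.map g) := inferInstance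
  refine le_antisymm ?_ ?_
  · -- push `μ∘g⁻¹ ≤ (μ∘g⁻¹ − ν∘g⁻¹) + ν∘g⁻¹` back along `g'`
    have h1 : μ.map g ≤ (μ.map g - ν.map g) + ν.map g := Measure.sub_le_iff_le_add.mp le_rfl
    have h2 : μ ≤ (μ.map g - ν.map g).map g' + ν := by
      have := Measure.map_mono h1 hg'
      rw [Measure.map_add _ _ hg', Measure.map_map hg' hg, Measure.map_map hg' hg, hg'g, Measure.map_id, Measure.map_id] at this
      exact this
    have h3 : μ - ν ≤ (μ.map g - ν.map g).map g' := Measure.sub_le_of_le_add h2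
    have := Measure.map_mono h3 hg
    rwa [Measure.map_map hg hg', hgg', Measure.map_id] at this
  · refine Measure.sub_le_of_le_add ?_
    have h1 : μ ≤ (μ - ν) + ν := Measure.sub_le_iff_le_add.mp le_rfl
    have := Measure.map_mono h1 hg
    rwa [Measure.map_add _ _ hg] at this

end MapSub

section DensityForm

variable {α : Type*} [MeasurableSpace α] {μ : Measure α}

/-- **Push-forward of a measure with density along a `μ`-preserving measurable bijection**: if `μ∘g⁻¹ = μ` and `g′` is a measurable two-sided inverse of `g`, then
`(f·μ)∘g⁻¹ = (f∘g′)·μ` for a measurable left inverse `g′` of `g` (`setLIntegral_map` on `g⁻¹' s`). [folklore] -/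
theorem map_withDensity_of_map_eq {g g' : α → α} (hg : Measurable g) (hg' : Measurable g') (hg'g : g' ∘ g = id)
    (hμ : μ.map g = μ) {f : α → ℝ≥0∞} (hf : Measurable f) :
    (μ.withDensity f).map g = μ.withDensity (f ∘ g') := by
  ext s hs
  have hpre : MeasurableSet (g ⁻¹' s) := hg hs
  rw [Measure.map_apply hg hs, withDensity_apply _ hpre, withDensity_apply _ hs]
  -- `∫⁻_{s} f∘g′ dμ = ∫⁻_{s} f∘g′ d(μ∘g⁻¹) = ∫⁻_{g⁻¹ s} f (g′ (g x)) dμ = ∫⁻_{g⁻¹ s} f dμ`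
  conv_rhs => rw [← hμ]
  rw [setLIntegral_map hs (hf.comp hg') hg]
  refine setLIntegral_congr_fun hpre (fun x _ => ?_)
  show f x = f (g' (g x))
  have : g' (g x) = x := congrFun hg'g x
  rw [this]

/-- **a.e. INVARIANCE OF A DENSITY from invariance of its measure**: if `μ∘g⁻¹ = μ`, `(f·μ)∘g⁻¹ = f·μ` (`f` measurable with finite integral) and `g′` is a measurable two-sided
left inverse of `g`, then `f∘g′ = f` `μ`-a.e. (`withDensity_eq_iff`). [folklore] -/
theorem comp_ae_eq_of_map_withDensity_eq {g g' : α → α} (hg : Measurable g) (hg' : Measurable g') (hg'g : g' ∘ g = id)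
    (hμ : μ.map g = μ) {f : α → ℝ≥0∞} (hf : Measurable f) (hfi : ∫⁻ x, f x ∂μ ≠ ⊤) (hinv : (μ.withDensity f).map g = μ.withDensity f) :
    (f ∘ g') =ᵐ[μ] f := by
  rw [map_withDensity_of_map_eq hg hg' hg'g hμ hf] at hinv
  have hfi' : ∫⁻ x, (f ∘ g') x ∂μ ≠ ⊤ := by
    have h := congrArg (fun ν : Measure α => ν Set.univ) hinv
    simp only [withDensity_apply _ MeasurableSet.univ, Measure.restrict_univ] at h
    rw [h]; exact hfi
  exact (withDensity_eq_iff (hf.comp hg').aemeasurable hf.aemeasurable hfi').1 hinv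

end DensityForm

section Floored

variable {P : Params} {G : Type} [GaugeGroup G] [MeasurableSpace G] [HaarData G] [MeasurableMul₂ G] {av : ∀ j, Averaging P j G}
  (hmeas : ∀ j, Measurable (av j).avg) (νs : ∀ k, Measure (GaugeField P k G)) (h0 : νs 0 = 0)
  (hsucc : ∀ k, νs (k + 1) = (fieldMeasure P k G + νs k).map (av k).avg - fieldMeasure P (k + 1) G)
include hmeas h0 hsucc

/-- ★★ **`dU_k + ν♯_k` IS GAUGE INVARIANT** for every excess-recursive family `ν♯` of file 17 §4 (`k ≤ m + K`): induction — `dU_0 + 0`; `dU_{k+1} + ν♯_{k+1} =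
dU_{k+1} + ((dU_k + ν♯_k)∘Ū_k⁻¹ − dU_{k+1})`, where the push-forward is invariant by §1 and the induction hypothesis, `dU_{k+1}` is invariant, and the truncated subtraction
commutes with the gauge action (§2 `map_sub_of_inverse`, inverse transformation `invTransf v`). [cite: Balaban1985Averaging, (11)+(12) p.19; Balaban1985UV3, (47) p.267 (bookkeeping)] -/
theorem map_gaugeAct_add_excessRec : ∀ k, k ≤ P.m + P.K → ∀ v : GaugeTransf P k G,
    (fieldMeasure P k G + νs k).map (GaugeField.gaugeAct v) = fieldMeasure P k G + νs k
  | 0, _, v => by rw [h0, add_zero]; exact (measurePreserving_gaugeAct v).map_eq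
  | k + 1, hk, v => by
    haveI : IsFiniteMeasure (νs k) := isFiniteMeasure_of_excessRec νs h0 hsucc k
    haveI : IsFiniteMeasure ((fieldMeasure P k G + νs k).map (av k).avg) := inferInstance
    have ih : ∀ u : GaugeTransf P k G, (fieldMeasure P k G + νs k).map (GaugeField.gaugeAct u) = fieldMeasure P k G + νs k :=
      map_gaugeAct_add_excessRec k (by omega)
    have hstep := map_gaugeAct_map_avg_of_invariant av hmeas (by omega) (fieldMeasure P k G + νs k) ih v
    have hinv1 : (GaugeField.gaugeAct v ∘ GaugeField.gaugeAct (invTransf v) : GaugeField P (k + 1) G → GaugeField P (k + 1) G) = id :=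
      funext fun U => gaugeAct_gaugeAct_inv v U
    have hinv2 : (GaugeField.gaugeAct (invTransf v) ∘ GaugeField.gaugeAct v : GaugeField P (k + 1) G → GaugeField P (k + 1) G) = id :=
      funext fun U => gaugeAct_inv_gaugeAct v U
    rw [hsucc k, Measure.map_add _ _ (measurable_gaugeAct v), (measurePreserving_gaugeAct v).map_eq,
      map_sub_of_inverse (measurable_gaugeAct v) (measurable_gaugeAct (invTransf v)) hinv1 hinv2, hstep, (measurePreserving_gaugeAct v).map_eq]

end Floored

section FlooredMass

variable {P : Params} {G : Type} [GaugeGroup G] [MeasurableSpace G] [HaarData G] [RegularGaugeGroup G] {av : ∀ j, Averaging P j G}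
  (νs : ∀ k, Measure (GaugeField P k G)) (h0 : νs 0 = 0)
  (hsucc : ∀ k, νs (k + 1) = (fieldMeasure P k G + νs k).map (av k).avg - fieldMeasure P (k + 1) G)
  (M₁ : ℕ) (Rcol : ℕ → ℕ) (εL εS : ℕ → ℝ) (hav : ∀ j, AvgAC (av j).avg)
include h0 hsucc hav

/-- ★★★ **THE FLOORED HAAR ITERATE IS A GAUGE-INVARIANT MEASURE: `(m_k(triv,·)·dU_k)∘(·)^v⁻¹ = m_k(triv,·)·dU_k`** for every level-`k` gauge transformation `v` (`k ≤ m + K`),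
along any covariant averaging family with `AvgAC`, any thresholds (file 28 §2: `m_k(triv,·)·dU_k = dU_k + ν♯_k`; §2 above).  By file 28 §1 this measure dominates every
history's mass measure; by file 30 it dominates every partial iterate of Haar. [cite: Balaban1985UV3, (41) p.266 + (47) p.267; Balaban1985Averaging, (11)+(12) p.19] -/
theorem map_gaugeAct_withDensity_massRecAC_triv {k : ℕ} (hk : k ≤ P.m + P.K) (v : GaugeTransf P k G) :
    ((fieldMeasure P k G).withDensity (fun V => ENNReal.ofReal (massRecAC M₁ Rcol εL εS av k (Hist.triv P k) V))).map (GaugeField.gaugeAct v) =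
      (fieldMeasure P k G).withDensity (fun V => ENNReal.ofReal (massRecAC M₁ Rcol εL εS av k (Hist.triv P k) V)) := by
  rw [withDensity_massRecAC_triv_eq_add_excessRec M₁ Rcol εL εS hav νs h0 hsucc k (by omega)]
  exact map_gaugeAct_add_excessRec (fun j => (hav j).1) νs h0 hsucc k hk v

/-- ★★ **… IN DENSITY CURRENCY: the floored Haar iterate is a GAUGE-INVARIANT FUNCTION a.e.** — `m_k(triv, V^v) = m_k(triv, V)` for `dU_k`-a.e. `V`, every level-`k` gauge
transformation `v` (`k ≤ m + K`): §2's measure invariance + gauge invariance of `dU_k` + uniqueness of densities (`withDensity_eq_iff`; the mass is integrable).  So the extensive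
sup-bound of the node's letter is a bound on a gauge-invariant function of the level-`k` field. [cite: Balaban1985UV3, (41) p.266 + (47) p.267; Balaban1985Averaging, (11)+(12) p.19] -/
theorem massRecAC_triv_comp_gaugeAct_ae_eq {k : ℕ} (hk : k ≤ P.m + P.K) (v : GaugeTransf P k G) :
    (fun V => massRecAC M₁ Rcol εL εS av k (Hist.triv P k) (GaugeField.gaugeAct v V)) =ᵐ[fieldMeasure P k G]
      massRecAC M₁ Rcol εL εS av k (Hist.triv P k) := by
  have hmeas : Measurable fun V => ENNReal.ofReal (massRecAC M₁ Rcol εL εS av k (Hist.triv P k) V) :=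
    (measurable_massRecAC M₁ Rcol εL εS av k _).ennreal_ofReal
  have hfi : ∫⁻ V, ENNReal.ofReal (massRecAC M₁ Rcol εL εS av k (Hist.triv P k) V) ∂(fieldMeasure P k G) ≠ ⊤ :=
    (integrable_massRecAC M₁ Rcol εL εS av k (Hist.triv P k)).lintegral_lt_top.ne
  -- apply §2b with `g = (·)^{v⁻¹}`, `g′ = (·)^{v}`
  have hinv2 : (GaugeField.gaugeAct v ∘ GaugeField.gaugeAct (invTransf v) : GaugeField P k G → GaugeField P k G) = id :=
    funext fun U => gaugeAct_gaugeAct_inv v U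
  have hae := comp_ae_eq_of_map_withDensity_eq (measurable_gaugeAct (invTransf v)) (measurable_gaugeAct v) hinv2
    (measurePreserving_gaugeAct (invTransf v)).map_eq hmeas hfi
    (map_gaugeAct_withDensity_massRecAC_triv νs h0 hsucc M₁ Rcol εL εS hav hk (invTransf v))
  filter_upwards [hae] with V hV
  have h0V := massRecAC_nonneg M₁ Rcol εL εS av k (Hist.triv P k) (GaugeField.gaugeAct v V)
  have h1V := massRecAC_nonneg M₁ Rcol εL εS av k (Hist.triv P k) V
  have hV' : ENNReal.ofReal (massRecAC M₁ Rcol εL εS av k (Hist.triv P k) (GaugeField.gaugeAct v V)) =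
      ENNReal.ofReal (massRecAC M₁ Rcol εL εS av k (Hist.triv P k) V) := hV
  exact (ENNReal.ofReal_eq_ofReal_iff h0V h1V).1 hV'

end FlooredMass

/-- ★★★ **THE FLOORED HAAR ITERATE IS GAUGE INVARIANT (hypothesis-free form)**: for any covariant averaging family with `AvgAC` and any thresholds, the trivial history's mass
measure `m_k(triv,·)·dU_k` is invariant under every level-`k` gauge transformation, `k ≤ m + K` (the excess-recursive family exists: file 17's `exists_excessRec`).
[cite: Balaban1985UV3, (41) p.266 + (47) p.267; Balaban1985Averaging, (11)+(12) p.19] -/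
theorem map_gaugeAct_withDensity_massRecAC_triv' {P : Params} {G : Type} [GaugeGroup G] [MeasurableSpace G] [HaarData G] [RegularGaugeGroup G]
    (M₁ : ℕ) (Rcol : ℕ → ℕ) (εL εS : ℕ → ℝ) (av : ∀ j, Averaging P j G) (hav : ∀ j, AvgAC (av j).avg) {k : ℕ} (hk : k ≤ P.m + P.K) (v : GaugeTransf P k G) :
    ((fieldMeasure P k G).withDensity (fun V => ENNReal.ofReal (massRecAC M₁ Rcol εL εS av k (Hist.triv P k) V))).map (GaugeField.gaugeAct v) =
      (fieldMeasure P k G).withDensity (fun V => ENNReal.ofReal (massRecAC M₁ Rcol εL εS av k (Hist.triv P k) V)) := by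
  obtain ⟨νs, h0, hsucc⟩ := exists_excessRec av
  exact map_gaugeAct_withDensity_massRecAC_triv νs h0 hsucc M₁ Rcol εL εS hav hk v

/-- ★★ **… and the a.e. gauge invariance of the floored iterate as a FUNCTION, hypothesis-free form** (`k ≤ m + K`). [cite: Balaban1985UV3, (41) p.266 + (47) p.267; Balaban1985Averaging, (11)+(12) p.19] -/
theorem massRecAC_triv_comp_gaugeAct_ae_eq' {P : Params} {G : Type} [GaugeGroup G] [MeasurableSpace G] [HaarData G] [RegularGaugeGroup G]
    (M₁ : ℕ) (Rcol : ℕ → ℕ) (εL εS : ℕ → ℝ) (av : ∀ j, Averaging P j G) (hav : ∀ j, AvgAC (av j).avg) {k : ℕ} (hk : k ≤ P.m + P.K) (v : GaugeTransf P k G) :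
    (fun V => massRecAC M₁ Rcol εL εS av k (Hist.triv P k) (GaugeField.gaugeAct v V)) =ᵐ[fieldMeasure P k G]
      massRecAC M₁ Rcol εL εS av k (Hist.triv P k) := by
  obtain ⟨νs, h0, hsucc⟩ := exists_excessRec av
  exact massRecAC_triv_comp_gaugeAct_ae_eq νs h0 hsucc M₁ Rcol εL εS hav hk v

/-! ## §3 At the [B10] slot's averaging -/
section Print

open Literature.MathematicalPhysics.QuantumFieldTheory.Balaban1985CMP102.Setting (Scales)
open Literature.MathematicalPhysics.QuantumFieldTheory.Balaban1983to89.B10RunsOfRecord (avOfPrint)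
open Literature.MathematicalPhysics.QuantumFieldTheory.Balaban1983to89.Node00 (SU)
open Summit.QuantumFields.YangMills.BalabanUVNodes.N08Thm2AtRecordBridgeInhabited (avgAC_avOfPrint)

variable (N : ℕ) [NeZero N] {L : ℕ} (S : Scales L) (M₁ : ℕ) (Rcol : ℕ → ℕ) (εL εS : ℕ → ℝ)

/-- ★★ **AT PRINT'S AVERAGING ON `SU(N)`: every partial iterated push-forward of Haar under [Balaban1985Averaging] (15), `(Ū_{k−1}∘⋯∘Ū_j)_*dU_j`, is invariant under every
level-`k` gauge transformation** (`j ≤ k ≤ K`). [cite: Balaban1985Averaging, (11)+(12)+(15) p.19; Balaban1985UV3, (2) p.256] -/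
theorem map_gaugeAct_partialIterates_avOfPrint (ι : ∀ j k : ℕ, Measure (GaugeField S.P k (SU N)))
    (hι0 : ∀ j, ι j j = fieldMeasure S.P j (SU N)) (hιs : ∀ j k, j ≤ k → ι j (k + 1) = (ι j k).map (avOfPrint N S k).avg)
    {k : ℕ} (hk : k ≤ S.K) {j : ℕ} (hj : j ≤ k) (v : GaugeTransf S.P k (SU N)) :
    (ι j k).map (GaugeField.gaugeAct v) = ι j k :=
  map_gaugeAct_partialIterates (avOfPrint N S) (fun j => (avgAC_avOfPrint N L S j).1) ι hι0 hιs k (by show k ≤ S.m + S.K; omega) j hj v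

/-- ★★★ **AT PRINT'S AVERAGING: the floored Haar iterate `f_k·dU_k = massRecAC … (avOfPrint N S) k triv · dU_k` — the EXACT transport residual of the [B10] slot (files 28–30) —
is invariant under every level-`k` gauge transformation**, `k ≤ K`, every `N`, any thresholds. [cite: Balaban1985UV3, (41) p.266 + (47) p.267; Balaban1985Averaging, (11)+(12)+(15) p.19] -/
theorem map_gaugeAct_withDensity_massRecAC_triv_avOfPrint {k : ℕ} (hk : k ≤ S.K) (v : GaugeTransf S.P k (SU N)) :
    ((fieldMeasure S.P k (SU N)).withDensity (fun V => ENNReal.ofReal (massRecAC M₁ Rcol εL εS (avOfPrint N S) k (Hist.triv S.P k) V))).map (GaugeField.gaugeAct v) =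
      (fieldMeasure S.P k (SU N)).withDensity (fun V => ENNReal.ofReal (massRecAC M₁ Rcol εL εS (avOfPrint N S) k (Hist.triv S.P k) V)) :=
  map_gaugeAct_withDensity_massRecAC_triv' M₁ Rcol εL εS (avOfPrint N S) (avgAC_avOfPrint N L S) (by show k ≤ S.m + S.K; omega) v

/-- ★★ **AT PRINT'S AVERAGING, DENSITY FORM: `massRecAC … (avOfPrint N S) k triv (V^v) = massRecAC … k triv V` for `dU_k`-a.e. `V`**, every `v`, `k ≤ K`.
[cite: Balaban1985UV3, (41) p.266 + (47) p.267; Balaban1985Averaging, (11)+(12)+(15) p.19] -/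
theorem massRecAC_triv_avOfPrint_comp_gaugeAct_ae_eq {k : ℕ} (hk : k ≤ S.K) (v : GaugeTransf S.P k (SU N)) :
    (fun V => massRecAC M₁ Rcol εL εS (avOfPrint N S) k (Hist.triv S.P k) (GaugeField.gaugeAct v V)) =ᵐ[fieldMeasure S.P k (SU N)]
      massRecAC M₁ Rcol εL εS (avOfPrint N S) k (Hist.triv S.P k) :=
  massRecAC_triv_comp_gaugeAct_ae_eq' M₁ Rcol εL εS (avOfPrint N S) (avgAC_avOfPrint N L S) (by show k ≤ S.m + S.K; omega) v

end Print

end Summit.QuantumFields.YangMills.BalabanUVNodes.N08FlooredIterateGaugeInvariant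

end
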